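import Summits.KontsevichZagierPeriods.KontsevichZagierPeriods.Theorems.LinRedNormalFormHoffmanSpanInKZFastCertXDerived

/-!
# Crux `LinRedNormalForm.HoffmanSpanInKZ` (stmt-KontsevichZagierPeriods-15044), line `Sketch`:
# fast mod-`p` transcript checkers, LOW-FOOTPRINT variant `X` — certified words, coverage, assembly

The kernel checks each chunk of a transcript inside ONE declaration, and what a single declaration may
consume is bounded (measured at weight `13`: a derived chunk citing `≈ 60k` vector entries, or `60`
double-shuffle rows, exceeds it; the chunks of `…FastCert` / `…FastChunks` rebuild a memory of all earlier
rows and decide equalities of functions `Fin N → Bool`, which dominates at `2032` rows).  This file keeps the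
row semantics of `LinRedNormalFormHoffmanSpanInKZFastCert` but changes the bookkeeping:
* citations are PACKED two-level references `i * 4096 + j` = row `j` of chunk `i` (for the chunk being checked,
  `j` counts backwards from the current row), fetched from the chunk list itself (`getX`, `citeX`) — no memory
  is rebuilt;
* the encoding round trips of generator words and Hoffman words are checked as equalities of LISTS
  (`codeOkL`), not of functions;
* the certified word codes and the coverage test use a binary TRIE on words (`CT`), not `List.contains` /
  `List.Mem` on lists of up to `2^(N-2)` codes.
Soundness is proved exactly as in `…FastCert` (`mem_spanP_of_drowOkX`, `good_of_dtableOkX`,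
`uP_mem_spanP_of_wrowOkX`, `good_of_wtableOkX`), assembled over chunks (`good_of_dchunks`, `good_of_wchunks`,
`cover_of_coverOkX`) into `edsCertificate_of_chunksX` through `edsCertificate_of_unitP`.

Sources: the reflection set-up of `LinRedNormalFormHoffmanSpanInKZFastCert` (this tree). [folklore]
-/

namespace Summit.KontsevichZagierPeriods.LinRedNormalForm.HoffmanSpanInKZ

open Literature.NumberTheory.Transcendental
open Summit.KontsevichZagierPeriods.MzvKernelInKZ.Negative
open Summit.KontsevichZagierPeriods.MzvKernelInKZ.TwoPosets
open Submodule

/-! ## A binary trie on words -/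

/-- Binary trie of words (lists of letters): `leaf` marks a stored word's end. [folklore] -/
inductive CT where
  /-- empty -/
  | nil
  /-- a stored word ends here -/
  | leaf
  /-- branch on the next letter (`false` left, `true` right) -/
  | node (l r : CT)

/-- Insert a word. [folklore] -/
def CT.ins : CT → List Bool → CT
  | _, [] => .leaf
  | .node l r, b :: bs => bif b then .node l (r.ins bs) else .node (l.ins bs) r
  | _, b :: bs => bif b then .node .nil (CT.nil.ins bs) else .node (CT.nil.ins bs) .nil

/-- Membership of a word. [folklore] -/
def CT.mem : CT → List Bool → Bool
  | .leaf, [] => true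
  | .node l r, b :: bs => bif b then r.mem bs else l.mem bs
  | _, _ => false

/-- The empty trie has no member. [folklore] -/
theorem CT.mem_nil (q : List Bool) : CT.nil.mem q = false := by
  cases q <;> rfl

/-- Membership in a branch node reads the child chosen by the first letter. [folklore] -/
theorem CT.mem_node_cons (l r : CT) (b : Bool) (qs : List Bool) :
    (CT.node l r).mem (b :: qs) = (bif b then r.mem qs else l.mem qs) := rfl

/-- A branch node has no empty member. [folklore] -/
theorem CT.mem_node_nil (l r : CT) : (CT.node l r).mem [] = false := rfl

/-- One insertion step below a branch node. [folklore] -/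
theorem CT.mem_ins_aux (l r : CT) (b : Bool) (bs q : List Bool)
    (ihl : ∀ q, (l.ins bs).mem q = true → q = bs ∨ l.mem q = true)
    (ihr : ∀ q, (r.ins bs).mem q = true → q = bs ∨ r.mem q = true)
    (h : (bif b then CT.node l (r.ins bs) else CT.node (l.ins bs) r).mem q = true) :
    q = b :: bs ∨ (CT.node l r).mem q = true := by
  cases q with
  | nil => cases b <;> simp [CT.mem_node_nil] at h
  | cons b' qs =>
    cases b <;> cases b' <;> simp only [cond_true, cond_false, CT.mem_node_cons] at h ⊢
    · rcases ihl qs h with rfl | h'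
      exacts [Or.inl rfl, Or.inr h']
    · exact Or.inr h
    · exact Or.inr h
    · rcases ihr qs h with rfl | h'
      exacts [Or.inl rfl, Or.inr h']

/-- A member after an insertion is the inserted word or an old member. [folklore] -/
theorem CT.mem_ins : ∀ (k : List Bool) (t : CT) (q : List Bool),
    (t.ins k).mem q = true → q = k ∨ t.mem q = true
  | [], t, q, h => by
    cases t <;> cases q <;> simp_all [CT.ins, CT.mem]
  | b :: bs, .node l r, q, h =>
    CT.mem_ins_aux l r b bs q (CT.mem_ins bs l) (CT.mem_ins bs r) (by simpa only [CT.ins] using h)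
  | b :: bs, .nil, q, h => by
    rcases CT.mem_ins_aux .nil .nil b bs q (CT.mem_ins bs .nil) (CT.mem_ins bs .nil)
      (by simpa only [CT.ins] using h) with h' | h'
    · exact Or.inl h'
    · cases q with
      | nil => simp [CT.mem_node_nil] at h'
      | cons b' qs => cases b' <;> simp [CT.mem_node_cons, CT.mem_nil] at h'
  | b :: bs, .leaf, q, h => by
    rcases CT.mem_ins_aux .nil .nil b bs q (CT.mem_ins bs .nil) (CT.mem_ins bs .nil)
      (by simpa only [CT.ins] using h) with h' | h'
    · exact Or.inl h'
    · cases q with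
      | nil => simp [CT.mem_node_nil] at h'
      | cons b' qs => cases b' <;> simp [CT.mem_node_cons, CT.mem_nil] at h'

/-- Insert the word codes (read in length `N`) of a list of word rows. [folklore] -/
def CT.insAll (N : ℕ) (t : CT) (T : List WRowP) : CT := T.foldl (fun t c => t.ins (wordOfCode N c.w)) t

/-- A member after inserting the rows' words is one of them or an old member. [folklore] -/
theorem CT.mem_insAll (N : ℕ) : ∀ (T : List WRowP) (t : CT) (q : List Bool),
    (CT.insAll N t T).mem q = true → q ∈ T.map (fun c => wordOfCode N c.w) ∨ t.mem q = true
  | [], _, _, h => Or.inr h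
  | c :: T, t, q, h => by
    rw [CT.insAll, List.foldl_cons] at h
    rcases CT.mem_insAll N T _ q h with h | h
    · exact Or.inl (List.mem_cons_of_mem _ (by simpa using h))
    · rcases CT.mem_ins _ t q h with rfl | h
      · exact Or.inl (by simp)
      · exact Or.inr h

/-! ## Word rows -/

/-- Accumulator of a word row with a general citation fetch. [folklore] -/
def WRowP.accX (p : ℕ) (get : ℕ → List (ℕ × ℕ)) (c : WRowP) : List (ℕ × ℕ) :=
  foldMergeC p get true c.E
    (foldInsC p ((c.P.map fun q => (q.1, (p - q.2 % p) % p)) ++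
        (c.H.map fun q => (codeOfWord (MZV.binaryWord q.1), (p - q.2 % p) % p))) [(c.w, 1 % p)])

/-- Word-row checker: Hoffman side conditions with LIST round trips, cited words in the trie of certified
words, empty accumulator. [folklore] -/
def wrowOkX (p N : ℕ) (get : ℕ → List (ℕ × ℕ)) (prev : CT) (c : WRowP) : Bool :=
  (c.H.all fun q => decide (MZV.IsHoffman q.1 ∧ MZV.weight q.1 = N ∧ Adm (bword N q.1) ∧
    wordOfCode N (codeOfWord (MZV.binaryWord q.1)) = MZV.binaryWord q.1)) &&
  c.P.all (fun q => prev.mem (wordOfCode N q.1)) && (c.accX p get).isEmpty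

/-- Word-table checker, threading the trie of certified words. [folklore] -/
def wtableOkX (p N : ℕ) (get : ℕ → List (ℕ × ℕ)) : CT → List WRowP → Bool
  | _, [] => true
  | prev, c :: T => wrowOkX p N get prev c && wtableOkX p N get (prev.ins (wordOfCode N c.w)) T

section WSound

variable {p N : ℕ}

/-- **Soundness of one word row** (for `1 < p`). [folklore] -/
theorem uP_mem_spanP_of_wrowOkX (hp : 1 < p) (get : ℕ → List (ℕ × ℕ))
    (hget : ∀ r, evalC p N (get r) ∈ spanP p N) (prev : CT)
    (hprev : ∀ c, prev.mem (wordOfCode N c) = true → uP p N c ∈ spanP p N) (c : WRowP)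
    (h : wrowOkX p N get prev c = true) : uP p N c.w ∈ spanP p N := by
  have hp0 : 0 < p := lt_trans Nat.zero_lt_one hp
  simp only [wrowOkX, Bool.and_eq_true, List.all_eq_true, decide_eq_true_eq] at h
  obtain ⟨⟨hH, hP⟩, hz⟩ := h
  have h0 := evalC_eq_zero_of_isEmpty (p := p) (N := N) hz
  rw [WRowP.accX, evalC_foldMergeC, evalC_foldInsC, evalC_append, evalC_cons, evalC_nil] at h0
  have eP : evalC p N (c.P.map fun q => (q.1, (p - q.2 % p) % p)) =
      -(c.P.map fun q => ((q.2 : ℕ) : ZMod p) • uP p N q.1).sum := by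
    induction c.P with
    | nil => simp
    | cons q P ih => rw [List.map_cons, List.map_cons, evalC_cons, List.sum_cons, ih, cast_neg_mod hp0, neg_add,
        neg_smul, uP]
  have eH : evalC p N (c.H.map fun q => (codeOfWord (MZV.binaryWord q.1), (p - q.2 % p) % p)) =
      -(c.H.map fun q => ((q.2 : ℕ) : ZMod p) • (Pi.single (wordOf N (wordOfCode N (codeOfWord
        (MZV.binaryWord q.1)))) (1 : ZMod p) : (Fin N → Bool) → ZMod p)).sum := by
    induction c.H with
    | nil => simp
    | cons q H ih => rw [List.map_cons, List.map_cons, evalC_cons, List.sum_cons, ih, cast_neg_mod hp0, neg_add,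
        neg_smul]
  have eE : (c.E.map fun q => ((citeC p true q.2 : ℕ) : ZMod p) • evalC p N (get q.1)).sum =
      -(c.E.map fun q => ((q.2 : ℕ) : ZMod p) • evalC p N (get q.1)).sum := by
    induction c.E with
    | nil => simp
    | cons q E ih => rw [List.map_cons, List.map_cons, List.sum_cons, List.sum_cons, ih, cast_citeC hp0, cond_true,
        neg_smul, neg_add]
  have h1p : ((1 % p : ℕ) : ZMod p) = 1 := by rw [Nat.mod_eq_of_lt hp, Nat.cast_one]
  rw [eP, eH, eE, h1p, one_smul, add_zero] at h0
  have h1 : uP p N c.w = (c.E.map fun q => ((q.2 : ℕ) : ZMod p) • evalC p N (get q.1)).sum +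
      ((c.P.map fun q => ((q.2 : ℕ) : ZMod p) • uP p N q.1).sum +
        (c.H.map fun q => ((q.2 : ℕ) : ZMod p) • (Pi.single (wordOf N (wordOfCode N (codeOfWord
          (MZV.binaryWord q.1)))) (1 : ZMod p) : (Fin N → Bool) → ZMod p)).sum) := by
    rw [← sub_eq_zero, ← h0, uP]; abel
  rw [h1]
  refine add_mem (sum_citesX_mem_spanP get hget (fun n => ((n : ℕ) : ZMod p)) c.E) (add_mem ?_ ?_)
  · refine list_sum_mem fun x hx => ?_
    obtain ⟨q, hq, rfl⟩ := List.mem_map.1 hx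
    exact smul_mem _ _ (hprev q.1 (hP q hq))
  · refine list_sum_mem fun x hx => ?_
    obtain ⟨q, hq, rfl⟩ := List.mem_map.1 hx
    obtain ⟨h1, h2, h3, h4⟩ := hH q hq
    rw [h4]
    exact smul_mem _ _ (single_bword_mem_spanP q.1 h1 h2 h3)

/-- **Soundness of the word-table checker.** [folklore] -/
theorem good_of_wtableOkX (hp : 1 < p) (get : ℕ → List (ℕ × ℕ)) (hget : ∀ r, evalC p N (get r) ∈ spanP p N) :
    ∀ (T : List WRowP) (prev : CT), (∀ c, prev.mem (wordOfCode N c) = true → uP p N c ∈ spanP p N) →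
      wtableOkX p N get prev T = true → ∀ c ∈ T, uP p N c.w ∈ spanP p N
  | [], _, _, _ => fun c hc => by simp at hc
  | c :: T, prev, hprev, h => by
    simp only [wtableOkX, Bool.and_eq_true] at h
    have hcw := uP_mem_spanP_of_wrowOkX hp get hget prev hprev c h.1
    intro c' hc'
    rcases List.mem_cons.1 hc' with rfl | hc'
    · exact hcw
    · refine good_of_wtableOkX hp get hget T (prev.ins (wordOfCode N c.w)) ?_ h.2 c' hc'
      intro c'' hc''
      rcases CT.mem_ins _ prev _ hc'' with he | hm
      · have : uP p N c'' = uP p N c.w := by rw [uP, uP, he]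
        rw [this]
        exact hcw
      · exact hprev c'' hm

end WSound

/-! ## Word chunks, coverage, assembly -/

/-- Citation fetch of the word rows: packed reference `i * 4096 + j` into ALL derived chunks. [folklore] -/
def getAllX (p : ℕ) (dch : List (List DRowP)) (ref : ℕ) : List (ℕ × ℕ) :=
  getX (memX p dch dch.length) (ref / 4096) (ref % 4096)

/-- The trie of the words certified by the first `k` word chunks. [folklore] -/
def trieX (N : ℕ) (wch : List (List WRowP)) (k : ℕ) : CT := CT.insAll N .nil (wch.take k).flatten

/-- Chunk `k` of a chunked word table checks against all derived chunks and the words certified before it.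
[folklore] -/
def wchunkOkX (p N : ℕ) (dch : List (List DRowP)) (wch : List (List WRowP)) (k : ℕ) : Bool :=
  wtableOkX p N (getAllX p dch) (trieX N wch k) (wch.getD k [])

/-- Coverage: every word of length `N` reading back as admissible is a certified word. [folklore] -/
def coverOkX (N : ℕ) (wch : List (List WRowP)) : Bool :=
  (allWords N).all fun l => !decide (Adm (wordOf N l)) || (trieX N wch wch.length).mem l

section WSound

variable {p N : ℕ}

/-- **Soundness of the chunked word table**: every certified word's unit vector lies in `spanP`. [folklore] -/
theorem good_of_wchunks (hp : 1 < p) (dch : List (List DRowP))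
    (hd : ∀ d ∈ dch.flatten, evalC p N (d.cvec p) ∈ spanP p N) (wch : List (List WRowP))
    (hw : ∀ k < wch.length, wchunkOkX p N dch wch k = true) : ∀ c ∈ wch.flatten, uP p N c.w ∈ spanP p N := by
  have hget : ∀ r, evalC p N (getAllX p dch r) ∈ spanP p N := by
    intro r
    unfold getAllX memX
    refine getX_prop (fun v => evalC p N v ∈ spanP p N) _ (by simp [evalC_nil]) ?_ _ _
    refine forall_pushAllG (fun ch : List (List (ℕ × ℕ)) => ∀ v ∈ ch, evalC p N v ∈ spanP p N) [] _
      (fun b hb => by simp at hb) ?_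
    intro vs hvs v hv
    obtain ⟨ch', hch', rfl⟩ := List.mem_map.1 hvs
    obtain ⟨d, hd', rfl⟩ := List.mem_map.1 hv
    rw [List.take_length] at hch'
    exact hd d (List.mem_flatten.2 ⟨ch', hch', hd'⟩)
  have key : ∀ k, k ≤ wch.length → ∀ c ∈ (wch.take k).flatten, uP p N c.w ∈ spanP p N := by
    intro k
    induction k with
    | zero => intro _ c hc; simp at hc
    | succ k ih =>
      intro hk c hc
      have hk' : k < wch.length := hk
      rw [List.take_succ_eq_append_getElem hk', List.flatten_append, List.flatten_singleton] at hc
      rcases List.mem_append.1 hc with hc | hc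
      · exact ih hk'.le c hc
      · have hcx := hw k hk'
        rw [wchunkOkX, List.getD_eq_getElem?_getD, List.getElem?_eq_getElem hk', Option.getD_some] at hcx
        refine good_of_wtableOkX hp _ hget _ (trieX N wch k) ?_ hcx c hc
        intro c' hc'
        rcases CT.mem_insAll N _ .nil _ hc' with hm | hm
        · obtain ⟨c'', hc'', he⟩ := List.mem_map.1 hm
          have : uP p N c' = uP p N c''.w := by rw [uP, uP, he]
          rw [this]
          exact ih hk'.le c'' hc''
        · rw [CT.mem_nil] at hm
          exact absurd hm Bool.false_ne_true
  intro c hc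
  exact key wch.length le_rfl c (by simpa using hc)

/-- **Coverage**: every admissible word is the read-back of a certified word's code. [folklore] -/
theorem cover_of_coverOkX (N : ℕ) (wch : List (List WRowP)) (h : coverOkX N wch = true) (ε : Fin N → Bool)
    (hε : Adm ε) : ∃ c ∈ wch.flatten, wordOf N (wordOfCode N c.w) = ε := by
  have hl : List.ofFn ε ∈ allWords N := by simpa using mem_allWords (List.ofFn ε)
  have := (List.all_eq_true.1 h) _ hl
  rw [wordOf_ofFn, Bool.or_eq_true, Bool.not_eq_true', decide_eq_false_iff_not] at this
  rcases this with h' | h'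
  · exact absurd hε h'
  · rcases CT.mem_insAll N _ .nil _ (by rwa [trieX, List.take_length] at h') with hm | hm
    · obtain ⟨c, hc, he⟩ := List.mem_map.1 hm
      exact ⟨c, hc, by rw [he, wordOf_ofFn]⟩
    · rw [CT.mem_nil] at hm
      exact absurd hm Bool.false_ne_true

end WSound

/-- **From low-footprint chunk facts to `EdsCertificate N`.** [folklore] -/
theorem edsCertificate_of_chunksX (p N : ℕ) [hp : Fact p.Prime] (dch : List (List DRowP)) (wch : List (List WRowP))
    (hd : ∀ k < dch.length, dchunkOkX p N dch k = true)
    (hw : ∀ k < wch.length, wchunkOkX p N dch wch k = true) (hc : coverOkX N wch = true) : EdsCertificate N := by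
  have hgood := good_of_dchunks hp.out.pos dch hd
  have hT := good_of_wchunks hp.out.one_lt dch hgood wch hw
  refine edsCertificate_of_unitP p N fun ε hε => ?_
  obtain ⟨c, hcm, hcw⟩ := cover_of_coverOkX N wch hc ε hε
  have hu := hT c hcm
  rwa [uP, hcw] at hu

/-! ## The registered stub -/

/-- Soundness of the low-footprint chunked checkers, as a statement about this file's checkers (not a
published fact). -/
def FastCertXSound : Prop :=
  ∀ (p N : ℕ) [Fact p.Prime] (dch : List (List DRowP)) (wch : List (List WRowP)),
    (∀ k < dch.length, dchunkOkX p N dch k = true) → (∀ k < wch.length, wchunkOkX p N dch wch k = true) →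
      coverOkX N wch = true → EdsCertificate N

/-- **Registered stub `stub_fastCertX`** of the skeleton of line `Sketch`: the low-footprint layout is
sound. -/
theorem stub_fastCertX : FastCertXSound := fun p N _ dch wch h₁ h₂ h₃ =>
  edsCertificate_of_chunksX p N dch wch h₁ h₂ h₃

/-! ## Smoke test (kernel), weight `4`, modulo `65521`: two derived chunks, two word chunks -/

/-- Smoke-test derived chunks (weight `4`; the citation of chunk `1` is the packed reference `0 * 4096 + 0`). -/
def dchX4 : List (List DRowP) :=
  [[⟨.F [2] [2], [], [(1, 65520), (3, 4)]⟩],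
   [⟨.D [3], [(0, 49141)], [(1, 16381), (5, 65520)]⟩, ⟨.K [2, 1, 1], [], [(1, 65520), (7, 1)]⟩]]

/-- Smoke-test word chunks (weight `4`; derived citations packed as `chunk * 4096 + offset`). -/
def wchX4 : List (List WRowP) :=
  [[⟨5, [], [([2, 2], 1)], []⟩, ⟨1, [], [([2, 2], 43682)], [(4096, 43682)]⟩],
   [⟨3, [(1, 49141)], [], [(0, 49141)]⟩, ⟨7, [(1, 1)], [], [(4097, 1)]⟩]]

example : dchunkOkX 65521 4 dchX4 0 = true := by decide +kernel
example : dchunkOkX 65521 4 dchX4 1 = true := by decide +kernel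
example : wchunkOkX 65521 4 dchX4 wchX4 0 = true := by decide +kernel
example : wchunkOkX 65521 4 dchX4 wchX4 1 = true := by decide +kernel
example : coverOkX 4 wchX4 = true := by decide +kernel

/-- Smoke test of the assembly shape: `EdsCertificate 4` from the chunk facts and coverage. -/
example : EdsCertificate 4 :=
  edsCertificate_of_chunksX 65521 4 dchX4 wchX4
    (forallLt_succ (n := 1)
      (forallLt_base (fun k => dchunkOkX 65521 4 dchX4 k = true) (by decide +kernel)) (by decide +kernel))
    (forallLt_succ (n := 1)
      (forallLt_base (fun k => wchunkOkX 65521 4 dchX4 wchX4 k = true) (by decide +kernel)) (by decide +kernel))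
    (by decide +kernel)

end Summit.KontsevichZagierPeriods.LinRedNormalForm.HoffmanSpanInKZ
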